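import Summits.AtomisticToContinuum.HydrodynamicLimit.Theorems.JParityClosureLocalSecondLawLedgerObs

/-!
# Pinned-cell tools for stub Q (`stub_pinnedRepresentation`) of the line `contact-asymmetry-information`
(crux `InformationPercolationEngine.LocalSecondLaw` ≡ `JParityClosure.LocalSecondLaw`, stmt-AtomisticToContinuum-13081)

The deterministic, `r`-INDEPENDENT core of the pinned representation.  Stub Q compares the PATHWISE crux integrand
`H(ρ_r, θ_r)(∂ₛφ + (m_r/ρ_r)·∇φ)` of a member of a pinned cell with the same integrand at the MEAN coarse fields of the
cell; both are the one function `cruxIntegrand σ a b (ρ, m, e) = H(ρ, θ(ρ,m,e))·(a + (m/ρ)·b)` of the conserved variables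
— exactly what the pinning controls — read at `(a, b) = (∂ₛφ, ∇φ)(s, x)`.  On the REGULAR BOX
`Box c D E = {c ≤ ρ ≤ D, c ≤ θ(ρ,m,e), e ≤ E}` with the cap inside the equation-of-state band (`Dσ³ ≤ η₁ < η₀`):
the box is bounded (`0 ≤ e`, `|m|² ≤ 2ρe ≤ 2DE`: Cauchy–Schwarz is built into `θ ≥ c`) and sits in a compact convex
product box; `(ρ,m,e) ↦ H(ρ,θ)` is the ledger line's `C¹` modification `Ĥ` there, hence Lipschitz and bounded
(`exists_lipschitz_Hs_on_Box`); the crux integrand is Lipschitz with constant `L(σ,c,D,E,η₀,η₁)·(|a| + Σₖ|bₖ|)` — NO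
dependence on `r` (`exists_lipschitz_cruxIntegrand`); a point within `ε₀(c,D,E)` of the box lies in the box with halved
floor and unit-enlarged caps (`exists_Box_stable`: how the MEAN field of a pinned cell, within `2η′` of every member but
not a member, inherits regularity); both combined: `exists_pinned_pointwise_bound`.  `cruxIntegrand_U` bridges to
configurations, and `abs_integral_cond_sub_le` ("means of pinned quantities are pinned", for ANY cell, under Mathlib's
`μ[|S]` = the line's `condLaw μ S`) is the only measure-theoretic input of the comparison that does not need regularity.
So on a cell pinned at resolution `η′ ≤ ε₀/2` whose members are box-regular on `[0,τ] × 𝕋³` the two integrands differ by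
`≤ 2 L C_φ η′` pointwise, uniformly in `r`: the regular box is the ONLY `r`-sensitive input of stub Q (line card).

References: mean value inequality (Mathlib `ContDiffOn.exists_lipschitzOnWith`); vocabulary of
`Theorems/JParityClosureLocalSecondLawLedgerHhat.lean` (`CV`, `thetaOf`, `Hhat`, `regNbhd`) and `…LedgerObs.lean` (`U`).
-/

noncomputable section
noncomputable section

namespace Summit.AtomisticToContinuum.HydrodynamicLimit.Theorems.LocalSecondLawPinned

open scoped BigOperators Topology NNReal
open Set
open Literature.MathematicalPhysics.KineticTheory
open Literature.Analysis.FluidPDE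
open Summit.AtomisticToContinuum.HydrodynamicLimit.Theorems.LocalSecondLawNegative
open Summit.AtomisticToContinuum.HydrodynamicLimit.Theorems.LocalSecondLawLedger
open Summit.AtomisticToContinuum.HydrodynamicLimit.Theorems.LocalSecondLawLedger.L

/-! ## The regular box of conserved variables and the crux integrand -/

/-- The temperature of a point of the conserved-variable space `CV = ℝ × (Fin 3 → ℝ) × ℝ`, `p = (ρ, m, e)`. [folklore] -/
abbrev Θ (p : CV) : ℝ := thetaOf p.1 p.2.2 p.2.1

/-- The REGULAR BOX of conserved variables: density floor and cap, temperature floor, energy cap. [folklore] -/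
def Box (c D E : ℝ) : Set CV := {p | c ≤ p.1 ∧ p.1 ≤ D ∧ c ≤ Θ p ∧ p.2.2 ≤ E}

/-- The crux integrand as a function of the conserved variables, at test-function data `(a, b) = (∂ₛφ, ∇φ)(s, x)`:
`H(ρ, θ(ρ,m,e)) · (a + ∑ₖ (mₖ/ρ) bₖ)`. [folklore] -/
def cruxIntegrand (σ a : ℝ) (b : Fin 3 → ℝ) (p : CV) : ℝ :=
  Hs σ p.1 (Θ p) * (a + ∑ k, p.2.1 k / p.1 * b k)

variable {N : ℕ}

/-- **Bridge to configurations**: at the conserved fields `U_r(w)(x) = (ρ_r, m_r, e_r)(x)` of a configuration the box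
integrand is the crux integrand `H(ρ_r, θ_r)(a + ∑ₖ (m_r)ₖ/ρ_r · bₖ)`. [folklore] -/
theorem cruxIntegrand_U (σ a : ℝ) (b : Fin 3 → ℝ) (r : ℝ) (w : Phase N) (x : T3) :
    cruxIntegrand σ a b (U r w x) =
      Hs σ (rhoC r w x) (thetaC r w x) * (a + ∑ k, momC r w x k / rhoC r w x * b k) := by
  have hθ : Θ (U r w x) = thetaC r w x := by
    show thetaOf (rhoC r w x) (kinC r w x) (WithLp.ofLp (momC r w x)) = thetaC r w x
    rw [thetaOf, thetaC_eq]
  unfold cruxIntegrand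
  rw [hθ]
  rfl

/-! ## Coordinates against the sup norm of `CV` -/

/-- The density coordinate is `1`-Lipschitz for the sup norm of `CV`. [folklore] -/
theorem abs_fst_sub_le (p q : CV) : |p.1 - q.1| ≤ ‖p - q‖ := by
  have h := norm_fst_le (p - q)
  rwa [Prod.fst_sub, Real.norm_eq_abs] at h

/-- The momentum coordinate is `1`-Lipschitz for the sup norm of `CV`. [folklore] -/
theorem norm_m_sub_le (p q : CV) : ‖p.2.1 - q.2.1‖ ≤ ‖p - q‖ := by
  have h := (norm_fst_le (p - q).2).trans (norm_snd_le (p - q))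
  rwa [Prod.snd_sub, Prod.fst_sub] at h

/-- Each momentum component is `1`-Lipschitz for the sup norm of `CV`. [folklore] -/
theorem abs_m_sub_le (p q : CV) (k : Fin 3) : |p.2.1 k - q.2.1 k| ≤ ‖p - q‖ := by
  have h : ‖(p.2.1 - q.2.1) k‖ ≤ ‖p.2.1 - q.2.1‖ := norm_le_pi_norm _ k
  rw [Pi.sub_apply, Real.norm_eq_abs] at h
  exact h.trans (norm_m_sub_le p q)

/-- The energy coordinate is `1`-Lipschitz for the sup norm of `CV`. [folklore] -/
theorem abs_e_sub_le (p q : CV) : |p.2.2 - q.2.2| ≤ ‖p - q‖ := by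
  have h := (norm_snd_le (p - q).2).trans (norm_snd_le (p - q))
  rwa [Prod.snd_sub, Prod.snd_sub, Real.norm_eq_abs] at h

/-! ## Boundedness of the box -/

section BoxBounds

variable {c D E : ℝ} (hc : 0 < c) {p : CV} (hp : p ∈ Box c D E)
include hc hp

/-- In the box the density is positive. [folklore] -/
theorem Box.rho_pos : 0 < p.1 := hc.trans_le hp.1

/-- In the box the temperature is positive. [folklore] -/
theorem Box.theta_pos : 0 < Θ p := hc.trans_le hp.2.2.1

/-- In the box `∑ₖ mₖ² ≤ 2ρe` (the floor `θ ≥ c > 0` contains Cauchy–Schwarz). [folklore] -/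
theorem Box.sum_sq_le_two_mul : ∑ k, p.2.1 k ^ 2 ≤ 2 * p.1 * p.2.2 := by
  have hρ : 0 < p.1 := Box.rho_pos hc hp
  have hθ : 0 < 2 / 3 * (p.2.2 / p.1 - (∑ k, p.2.1 k ^ 2) / (2 * p.1 ^ 2)) := Box.theta_pos hc hp
  have h1 : (∑ k, p.2.1 k ^ 2) / (2 * p.1 ^ 2) ≤ p.2.2 / p.1 := by linarith
  rw [div_le_div_iff₀ (by positivity) hρ] at h1
  exact le_of_mul_le_mul_right (by nlinarith [h1] : (∑ k, p.2.1 k ^ 2) * p.1 ≤ (2 * p.1 * p.2.2) * p.1) hρ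

/-- In the box the energy is non-negative. [folklore] -/
theorem Box.e_nonneg : 0 ≤ p.2.2 := by
  have hS : 0 ≤ ∑ k, p.2.1 k ^ 2 := Finset.sum_nonneg fun k _ => sq_nonneg _
  nlinarith [Box.rho_pos hc hp, Box.sum_sq_le_two_mul hc hp]

/-- In the box `∑ₖ mₖ² ≤ 2DE`. [folklore] -/
theorem Box.sum_sq_le : ∑ k, p.2.1 k ^ 2 ≤ 2 * D * E := by
  have hρ : 0 < p.1 := Box.rho_pos hc hp
  have he : 0 ≤ p.2.2 := Box.e_nonneg hc hp
  have h1 : 2 * p.1 * p.2.2 ≤ 2 * D * p.2.2 := by nlinarith [hp.2.1]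
  have h2 : 2 * D * p.2.2 ≤ 2 * D * E := by nlinarith [hp.2.2.2, hρ.le.trans hp.2.1]
  linarith [Box.sum_sq_le_two_mul hc hp]

/-- In the box every momentum component is at most `√(2DE)`. [folklore] -/
theorem Box.abs_m_le (k : Fin 3) : |p.2.1 k| ≤ Real.sqrt (2 * D * E) :=
  Real.abs_le_sqrt ((Finset.single_le_sum (fun j _ => sq_nonneg (p.2.1 j)) (Finset.mem_univ k)).trans
    (Box.sum_sq_le hc hp))

/-- In the box the momentum lies in the closed sup-norm ball of radius `√(2DE)`. [folklore] -/
theorem Box.norm_m_le : ‖p.2.1‖ ≤ Real.sqrt (2 * D * E) :=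
  (pi_norm_le_iff_of_nonneg (Real.sqrt_nonneg _)).2 fun k => by
    rw [Real.norm_eq_abs]; exact Box.abs_m_le hc hp k

end BoxBounds

/-- The compact convex PRODUCT box containing the regular box. [folklore] -/
def bigBox (c D M e₀ E : ℝ) : Set CV :=
  Icc c D ×ˢ (Metric.closedBall (0 : Fin 3 → ℝ) M ×ˢ Icc e₀ E)

/-- The product box is compact. [folklore] -/
theorem isCompact_bigBox (c D M e₀ E : ℝ) : IsCompact (bigBox c D M e₀ E) :=
  isCompact_Icc.prod ((isCompact_closedBall _ _).prod isCompact_Icc)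

/-- The product box is convex. [folklore] -/
theorem convex_bigBox (c D M e₀ E : ℝ) : Convex ℝ (bigBox c D M e₀ E) :=
  (convex_Icc c D).prod ((convex_closedBall _ _).prod (convex_Icc e₀ E))

/-- Membership in the product box, coordinatewise. [folklore] -/
theorem mem_bigBox {c D M e₀ E : ℝ} {p : CV} :
    p ∈ bigBox c D M e₀ E ↔ (c ≤ p.1 ∧ p.1 ≤ D) ∧ ‖p.2.1‖ ≤ M ∧ e₀ ≤ p.2.2 ∧ p.2.2 ≤ E := by
  simp only [bigBox, mem_prod, mem_Icc, Metric.mem_closedBall, dist_zero_right]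

/-- The regular box sits in the product box `[c, D] × B̄(0, √(2DE)) × [0, E]`. [folklore] -/
theorem Box_subset_bigBox {c : ℝ} (hc : 0 < c) (D E : ℝ) :
    Box c D E ⊆ bigBox c D (Real.sqrt (2 * D * E)) 0 E := fun _ hp =>
  mem_bigBox.2 ⟨⟨hp.1, hp.2.1⟩, Box.norm_m_le hc hp, Box.e_nonneg hc hp, hp.2.2.2⟩

/-- Boxes are monotone in their parameters. [folklore] -/
theorem Box_mono {c c' D D' E E' : ℝ} (hc : c' ≤ c) (hD : D ≤ D') (hE : E ≤ E') : Box c D E ⊆ Box c' D' E' :=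
  fun _ hp => ⟨hc.trans hp.1, hp.2.1.trans hD, hc.trans hp.2.2.1, hp.2.2.2.trans hE⟩

/-! ## The entropy density on the box: Lipschitz and bounded, uniformly (no `r`) -/

section Entropy

variable {σ c η₀ η₁ D : ℝ} {F : ℝ → ℝ} (hE : EosBand η₀ F) (hη : 0 < η₁) (hη₁ : η₁ < η₀) (hσ : 0 < σ)
  (hc : 0 < c) (hD : D * σ ^ 3 ≤ η₁)

include hη₁ hσ hc hD in
/-- On the box the guarded entropy is the ledger line's `C¹` modification `Ĥ`. [folklore] -/
theorem Hs_eq_Hhat_of_mem_Box {E : ℝ} {p : CV} (hp : p ∈ Box c D E) :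
    Hs σ p.1 (Θ p) = Hhat σ c η₀ η₁ p := by
  have hcap : p.1 * σ ^ 3 ≤ η₁ := (mul_le_mul_of_nonneg_right hp.2.1 (by positivity)).trans hD
  have hmem : p ∈ regNbhd σ c η₀ η₁ := mem_regNbhd_of_regular hη₁ hc hp.1 hp.2.2.1 hcap
  rw [Hhat_eq_Hsm hη₁ hc hmem, Hs_eq_Hsm (Box.rho_pos hc hp) (Box.theta_pos hc hp)]

include hE hη hη₁ hσ hc hD in
/-- **The entropy density is Lipschitz and bounded on the regular box** in the conserved variables, with constants
depending on `(σ, c, D, E, η₀, η₁)` only. [folklore] -/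
theorem exists_lipschitz_Hs_on_Box (E : ℝ) :
    ∃ K H : ℝ, 0 ≤ K ∧ 0 ≤ H ∧
      (∀ p ∈ Box c D E, ∀ q ∈ Box c D E, |Hs σ p.1 (Θ p) - Hs σ q.1 (Θ q)| ≤ K * ‖p - q‖) ∧
      ∀ p ∈ Box c D E, |Hs σ p.1 (Θ p)| ≤ H := by
  have hsm := contDiff_Hhat hE hη hη₁ hσ hc (σ := σ)
  have hsub := Box_subset_bigBox hc D E
  have hcpt := isCompact_bigBox c D (Real.sqrt (2 * D * E)) 0 E
  obtain ⟨K, hK⟩ := hsm.contDiffOn.exists_lipschitzOnWith one_ne_zero (convex_bigBox _ _ _ _ _) hcpt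
  obtain ⟨C, hC⟩ := hcpt.exists_bound_of_continuousOn hsm.continuous.continuousOn
  refine ⟨K, max C 0, K.2, le_max_right _ _, fun p hp q hq => ?_, fun p hp => ?_⟩
  · rw [Hs_eq_Hhat_of_mem_Box hη₁ hσ hc hD hp, Hs_eq_Hhat_of_mem_Box hη₁ hσ hc hD hq, ← Real.dist_eq, ← dist_eq_norm]
    exact hK.dist_le_mul p (hsub hp) q (hsub hq)
  · rw [Hs_eq_Hhat_of_mem_Box hη₁ hσ hc hD hp, ← Real.norm_eq_abs]
    exact (hC p (hsub hp)).trans (le_max_left _ _)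

end Entropy

/-! ## The crux integrand is Lipschitz on the box -/

/-- Difference of two velocities `m/ρ − m'/ρ'` under floors and caps. [folklore] -/
theorem abs_div_sub_div_le {c D M m m' ρ ρ' δ : ℝ} (hc : 0 < c) (hρ : c ≤ ρ) (hρ' : c ≤ ρ') (hρ'D : ρ' ≤ D)
    (hm' : |m'| ≤ M) (hdm : |m - m'| ≤ δ) (hdρ : |ρ - ρ'| ≤ δ) :
    |m / ρ - m' / ρ'| ≤ (|D| + M) / c ^ 2 * δ := by
  have hρ0 : 0 < ρ := hc.trans_le hρ
  have hρ0' : 0 < ρ' := hc.trans_le hρ'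
  have hδ : 0 ≤ δ := (abs_nonneg _).trans hdm
  have hM : 0 ≤ M := (abs_nonneg _).trans hm'
  rw [div_sub_div _ _ hρ0.ne' hρ0'.ne', abs_div, abs_of_pos (mul_pos hρ0 hρ0')]
  have hnum : |m * ρ' - ρ * m'| ≤ (|D| + M) * δ := by
    rw [show m * ρ' - ρ * m' = (m - m') * ρ' + m' * (ρ' - ρ) by ring]
    calc |(m - m') * ρ' + m' * (ρ' - ρ)| ≤ |(m - m') * ρ'| + |m' * (ρ' - ρ)| := abs_add_le _ _
      _ = |m - m'| * ρ' + |m'| * |ρ - ρ'| := by rw [abs_mul, abs_mul, abs_of_pos hρ0', abs_sub_comm ρ' ρ]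
      _ ≤ δ * |D| + M * δ := add_le_add (mul_le_mul hdm (hρ'D.trans (le_abs_self D)) hρ0'.le hδ)
          (mul_le_mul hm' hdρ (abs_nonneg _) hM)
      _ = (|D| + M) * δ := by ring
  have hden : c ^ 2 ≤ ρ * ρ' := by rw [sq]; exact mul_le_mul hρ hρ' hc.le hρ0.le
  calc |m * ρ' - ρ * m'| / (ρ * ρ') ≤ (|D| + M) * δ / c ^ 2 :=
        div_le_div₀ (by positivity) hnum (by positivity) hden
    _ = (|D| + M) / c ^ 2 * δ := by ring

section Lipschitz

variable {σ c η₀ η₁ D : ℝ} {F : ℝ → ℝ} (hE : EosBand η₀ F) (hη : 0 < η₁) (hη₁ : η₁ < η₀) (hσ : 0 < σ)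
  (hc : 0 < c) (hD : D * σ ^ 3 ≤ η₁)
include hE hη hη₁ hσ hc hD

/-- **The crux integrand is Lipschitz on the regular box**, with constant `L·(|a| + ∑ₖ|bₖ|)`, `L = L(σ, c, D, E, η₀, η₁)`
— uniformly in the coarse-graining radius, which does not enter. [folklore] -/
theorem exists_lipschitz_cruxIntegrand (E : ℝ) :
    ∃ L : ℝ, 0 ≤ L ∧ ∀ (a : ℝ) (b : Fin 3 → ℝ), ∀ p ∈ Box c D E, ∀ q ∈ Box c D E,
      |cruxIntegrand σ a b p - cruxIntegrand σ a b q| ≤ L * (|a| + ∑ k, |b k|) * ‖p - q‖ := by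
  obtain ⟨K, H, hK0, hH0, hK, hH⟩ := exists_lipschitz_Hs_on_Box hE hη hη₁ hσ hc hD E
  set M : ℝ := Real.sqrt (2 * D * E) with hM
  have hM0 : 0 ≤ M := Real.sqrt_nonneg _
  set A₁ : ℝ := max 1 (M / c) with hA₁
  set A₂ : ℝ := (|D| + M) / c ^ 2 with hA₂
  have hA₁1 : 1 ≤ A₁ := le_max_left _ _
  have hA₂0 : 0 ≤ A₂ := by positivity
  refine ⟨K * A₁ + H * A₂, by positivity, fun a b p hp q hq => ?_⟩
  set δ := ‖p - q‖ with hδ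
  set B := |a| + ∑ k, |b k| with hB
  have hbB : ∑ k, |b k| ≤ B := by rw [hB]; linarith [abs_nonneg a]
  -- velocities and their differences
  have hu : ∀ k, |p.2.1 k / p.1| ≤ M / c := fun k => by
    rw [abs_div, abs_of_pos (Box.rho_pos hc hp)]
    exact div_le_div₀ hM0 (Box.abs_m_le hc hp k) hc hp.1
  have hdu : ∀ k, |p.2.1 k / p.1 - q.2.1 k / q.1| ≤ A₂ * δ := fun k =>
    abs_div_sub_div_le hc hp.1 hq.1 hq.2.1 (Box.abs_m_le hc hq k) (abs_m_sub_le p q k) (abs_fst_sub_le p q)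
  -- the multiplier and its difference
  set wp := a + ∑ k, p.2.1 k / p.1 * b k with hwp
  set wq := a + ∑ k, q.2.1 k / q.1 * b k with hwq
  have hw : |wp| ≤ A₁ * B := by
    calc |wp| ≤ |a| + |∑ k, p.2.1 k / p.1 * b k| := abs_add_le _ _
      _ ≤ |a| + ∑ k, |p.2.1 k / p.1 * b k| := add_le_add le_rfl (Finset.abs_sum_le_sum_abs _ _)
      _ ≤ |a| + ∑ k, M / c * |b k| := add_le_add le_rfl (Finset.sum_le_sum fun k _ => by
          rw [abs_mul]; exact mul_le_mul_of_nonneg_right (hu k) (abs_nonneg _))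
      _ = |a| + M / c * ∑ k, |b k| := by rw [Finset.mul_sum]
      _ ≤ A₁ * |a| + A₁ * ∑ k, |b k| := add_le_add (le_mul_of_one_le_left (abs_nonneg _) hA₁1)
          (mul_le_mul_of_nonneg_right (le_max_right _ _) (by positivity))
      _ = A₁ * B := by rw [hB]; ring
  have hdw : |wp - wq| ≤ A₂ * δ * B := by
    have hsplit : wp - wq = ∑ k, (p.2.1 k / p.1 - q.2.1 k / q.1) * b k := by
      rw [hwp, hwq, add_sub_add_left_eq_sub, ← Finset.sum_sub_distrib]
      refine Finset.sum_congr rfl fun k _ => ?_; ring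
    rw [hsplit]
    calc |∑ k, (p.2.1 k / p.1 - q.2.1 k / q.1) * b k| ≤ ∑ k, |(p.2.1 k / p.1 - q.2.1 k / q.1) * b k| :=
          Finset.abs_sum_le_sum_abs _ _
      _ ≤ ∑ k, A₂ * δ * |b k| := Finset.sum_le_sum fun k _ => by
          rw [abs_mul]; exact mul_le_mul_of_nonneg_right (hdu k) (abs_nonneg _)
      _ = A₂ * δ * ∑ k, |b k| := by rw [Finset.mul_sum]
      _ ≤ A₂ * δ * B := mul_le_mul_of_nonneg_left hbB (by positivity)
  -- assemble with the entropy factor and its difference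
  rw [show cruxIntegrand σ a b p - cruxIntegrand σ a b q =
      (Hs σ p.1 (Θ p) - Hs σ q.1 (Θ q)) * wp + Hs σ q.1 (Θ q) * (wp - wq) by unfold cruxIntegrand; rw [hwp, hwq]; ring]
  calc |(Hs σ p.1 (Θ p) - Hs σ q.1 (Θ q)) * wp + Hs σ q.1 (Θ q) * (wp - wq)|
      ≤ |Hs σ p.1 (Θ p) - Hs σ q.1 (Θ q)| * |wp| + |Hs σ q.1 (Θ q)| * |wp - wq| := by
        rw [← abs_mul, ← abs_mul]; exact abs_add_le _ _
    _ ≤ K * δ * (A₁ * B) + H * (A₂ * δ * B) := add_le_add (mul_le_mul (hK p hp q hq) hw (abs_nonneg _) (by positivity))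
        (mul_le_mul (hH q hq) hdw (abs_nonneg _) hH0)
    _ = (K * A₁ + H * A₂) * (|a| + ∑ k, |b k|) * ‖p - q‖ := by rw [hB, hδ]; ring

end Lipschitz

/-! ## Stability of the box under small perturbations (how the mean field inherits regularity) -/

/-- The temperature is `C¹` off the vacuum. [folklore] -/
theorem contDiffAt_theta {p : CV} (hp : p.1 ≠ 0) : ContDiffAt ℝ 1 Θ p := by
  have h1 : ContDiffAt ℝ 1 (fun q : CV => q.1) p := contDiff_fst.contDiffAt
  have h2 : ContDiffAt ℝ 1 (fun q : CV => q.2.2) p := (contDiff_snd.comp contDiff_snd).contDiffAt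
  have h3 : ContDiffAt ℝ 1 (fun q : CV => ∑ k, q.2.1 k ^ 2) p :=
    (ContDiff.sum fun k _ => ((contDiff_apply ℝ ℝ k).comp (contDiff_fst.comp contDiff_snd)).pow 2).contDiffAt
  have h4 : ContDiffAt ℝ 1 (fun q : CV => 2 * q.1 ^ 2) p := (contDiff_const.mul (contDiff_fst.pow 2)).contDiffAt
  show ContDiffAt ℝ 1 (fun q : CV => 2 / 3 * (q.2.2 / q.1 - (∑ k, q.2.1 k ^ 2) / (2 * q.1 ^ 2))) p
  exact contDiffAt_const.mul ((h2.div h1 hp).sub (h3.div h4 (by positivity)))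

/-- The temperature is Lipschitz on every product box off the vacuum. [folklore] -/
theorem exists_lipschitz_theta {c D M e₀ E : ℝ} (hc : 0 < c) :
    ∃ K : ℝ≥0, LipschitzOnWith K Θ (bigBox c D M e₀ E) := by
  have h : ContDiffOn ℝ 1 Θ (bigBox c D M e₀ E) := fun p hp =>
    (contDiffAt_theta (hc.trans_le (mem_bigBox.1 hp).1.1).ne').contDiffWithinAt
  exact h.exists_lipschitzOnWith one_ne_zero (convex_bigBox _ _ _ _ _) (isCompact_bigBox _ _ _ _ _)

/-- **Stability of the regular box**: there is `ε₀ = ε₀(c, D, E) > 0` such that every point within `ε₀` (sup norm of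
`CV`) of a point of `Box c D E` lies in `Box (c/2) (D+1) (E+1)`. [folklore] -/
theorem exists_Box_stable {c : ℝ} (hc : 0 < c) (D E : ℝ) :
    ∃ ε₀ : ℝ, 0 < ε₀ ∧ ∀ p q : CV, q ∈ Box c D E → ‖p - q‖ ≤ ε₀ → p ∈ Box (c / 2) (D + 1) (E + 1) := by
  set M : ℝ := Real.sqrt (2 * D * E) with hM
  have hM0 : 0 ≤ M := Real.sqrt_nonneg _
  obtain ⟨K, hK⟩ := exists_lipschitz_theta (D := D + 1) (M := M + 1) (e₀ := -1) (E := E + 1) (half_pos hc)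
  set ε₀ : ℝ := min (c / 2) (min 1 (c / (2 * ((K : ℝ) + 1)))) with hε₀
  have hK0 : 0 ≤ (K : ℝ) := K.2
  have hε₁ : ε₀ ≤ c / 2 := min_le_left _ _
  have hε₂ : ε₀ ≤ 1 := (min_le_right _ _).trans (min_le_left _ _)
  have hε₃ : ε₀ ≤ c / (2 * ((K : ℝ) + 1)) := (min_le_right _ _).trans (min_le_right _ _)
  refine ⟨ε₀, lt_min (half_pos hc) (lt_min one_pos (by positivity)), fun p q hq hpq => ?_⟩
  have hρ := abs_fst_sub_le p q
  have he := abs_e_sub_le p q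
  rw [abs_le] at hρ he
  have hqe : 0 ≤ q.2.2 := Box.e_nonneg hc hq
  have hqm : ‖q.2.1‖ ≤ M := Box.norm_m_le hc hq
  -- both points lie in the enlarged product box
  have hpB : p ∈ bigBox (c / 2) (D + 1) (M + 1) (-1) (E + 1) := by
    refine mem_bigBox.2 ⟨⟨by linarith [hq.1], by linarith [hq.2.1]⟩, ?_, by linarith, by linarith [hq.2.2.2]⟩
    exact (norm_le_norm_add_norm_sub' _ _).trans (add_le_add hqm ((norm_m_sub_le p q).trans (hpq.trans hε₂)))
  have hqB : q ∈ bigBox (c / 2) (D + 1) (M + 1) (-1) (E + 1) :=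
    mem_bigBox.2 ⟨⟨by linarith [hq.1], by linarith [hq.2.1]⟩, by linarith, by linarith, by linarith [hq.2.2.2]⟩
  -- the temperature moves by at most `c/2`
  have hθ : |Θ p - Θ q| ≤ c / 2 := by
    have h1 : |Θ p - Θ q| ≤ K * ‖p - q‖ := by
      rw [← Real.dist_eq, ← dist_eq_norm]; exact hK.dist_le_mul p hpB q hqB
    have h2 : (K : ℝ) * ‖p - q‖ ≤ K * (c / (2 * ((K : ℝ) + 1))) := mul_le_mul_of_nonneg_left (hpq.trans hε₃) hK0
    have h3 : (K : ℝ) * (c / (2 * ((K : ℝ) + 1))) ≤ c / 2 := by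
      rw [mul_div_assoc', div_le_div_iff₀ (by positivity) (by positivity)]; nlinarith
    linarith
  rw [abs_le] at hθ
  exact ⟨by linarith [hq.1], by linarith [hq.2.1], by linarith [hq.2.2.1], by linarith [hq.2.2.2]⟩

/-! ## The pointwise core of stub Q -/

/-- **Pinned pointwise bound** (registered sub-goal `exists_pinned_pointwise_bound` of stub `stub_pinnedRepresentation`; its
`r`-independent core): with the floor halved and the caps enlarged inside the band (`(D+1)σ³ ≤ η₁ < η₀`) there are `L ≥ 0`,
`ε₀ > 0` depending on `(σ, c, D, E, η₀, η₁)` only such that for `q ∈ Box c D E` and any `p` within `ε₀` of `q` (e.g. `q` the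
conserved fields of a box-regular member of a cell pinned at resolution `η′ ≤ ε₀/2`, `p` the mean fields of the cell) the
crux integrands differ by at most `L (|a| + ∑ₖ|bₖ|) ‖p − q‖`. [folklore] -/
theorem exists_pinned_pointwise_bound :
  ∀ {σ c η₀ η₁ D : ℝ} {F : ℝ → ℝ}, EosBand η₀ F → 0 < η₁ → η₁ < η₀ → 0 < σ → 0 < c → (D + 1) * σ ^ 3 ≤ η₁ → ∀ E : ℝ, ∃ L ε₀ : ℝ, 0 ≤ L ∧ 0 < ε₀ ∧ ∀ (a : ℝ) (b : Fin 3 → ℝ) (p q : CV), q ∈ Box c D E → ‖p - q‖ ≤ ε₀ → |cruxIntegrand σ a b p - cruxIntegrand σ a b q| ≤ L * (|a| + ∑ k, |b k|) * ‖p - q‖ := by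
  intro σ c η₀ η₁ D F hE hη hη₁ hσ hc hD E
  obtain ⟨ε₀, hε₀, hst⟩ := exists_Box_stable hc D E
  obtain ⟨L, hL0, hL⟩ := exists_lipschitz_cruxIntegrand hE hη hη₁ hσ (half_pos hc) hD (E + 1)
  refine ⟨L, ε₀, hL0, hε₀, fun a b p q hq hpq => hL a b p (hst p q hq hpq) q ?_⟩
  exact Box_mono (by linarith) (by linarith) (by linarith) hq

/-! ## Means of pinned quantities are pinned (any cell, measurable or not) -/

section Means

open MeasureTheory ProbabilityTheory

/-- **Means of pinned quantities are pinned** — for ANY set `S` (measurable or not) of positive mass of a finite measure: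
if a measurable real function is within `η′` of `a` on `S`, so is its mean under `μ[|S] = (μ S)⁻¹ • μ.restrict S` (the
line's `condLaw μ S`, definitionally; a probability measure, `cond_isProbabilityMeasure`).  Only the measurability of the
FUNCTION is used: the violation set is measurable and misses `S`, hence is `μ.restrict S`-null (`Measure.restrict_apply`
needs the measurability of its argument, not of `S`). [folklore] -/
theorem abs_integral_cond_sub_le {α : Type*} [MeasurableSpace α] (μ : Measure α) [IsFiniteMeasure μ] {S : Set α}
    (hS : μ S ≠ 0) {g : α → ℝ} (hg : Measurable g) {a η' : ℝ} (h : ∀ z ∈ S, |g z - a| ≤ η') :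
    |∫ z, g z ∂(μ[|S]) - a| ≤ η' := by
  haveI := cond_isProbabilityMeasure (μ := μ) hS
  have hmeas : MeasurableSet {z | η' < |g z - a|} :=
    measurableSet_lt measurable_const ((hg.sub measurable_const).abs)
  have hae : ∀ᵐ z ∂(μ[|S]), ‖g z - a‖ ≤ η' := by
    rw [ae_iff]
    have hset : {z | ¬‖g z - a‖ ≤ η'} = {z | η' < |g z - a|} := by
      ext z; simp only [Set.mem_setOf_eq, Real.norm_eq_abs, not_le]
    have hempty : {z | η' < |g z - a|} ∩ S = ∅ := by
      ext z
      simp only [Set.mem_inter_iff, Set.mem_setOf_eq, Set.mem_empty_iff_false, iff_false, not_and]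
      exact fun hz hzS => absurd (h z hzS) (not_le.2 hz)
    rw [hset, ProbabilityTheory.cond, Measure.smul_apply, Measure.restrict_apply hmeas, hempty, measure_empty, smul_zero]
  have hgi : Integrable g (μ[|S]) := by
    refine Integrable.of_bound hg.aestronglyMeasurable (|a| + η') ?_
    filter_upwards [hae] with z hz
    rw [Real.norm_eq_abs] at hz ⊢
    calc |g z| = |(g z - a) + a| := by rw [sub_add_cancel]
      _ ≤ |g z - a| + |a| := abs_add_le _ _
      _ ≤ η' + |a| := add_le_add hz le_rfl
      _ = |a| + η' := add_comm _ _
  have hsub : ∫ z, g z ∂(μ[|S]) - a = ∫ z, (g z - a) ∂(μ[|S]) := by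
    rw [integral_sub hgi (integrable_const a), integral_const, probReal_univ, one_smul]
  rw [hsub, ← Real.norm_eq_abs]
  have hb := norm_integral_le_of_norm_le_const hae
  rwa [probReal_univ, mul_one] at hb

end Means

end Summit.AtomisticToContinuum.HydrodynamicLimit.Theorems.LocalSecondLawPinned

end
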